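import Mathlib
import Summits.Ventures.HodgeRepro2.A2Separation
import Summits.Ventures.HodgeRepro2.A2Primitive

/-!
# T6A2Conj — sub-claim A2, the Galois-indexed embeddings of a Galois CM field, the eigenvalue sets
`Λ`, `Λ_W ⊂ K` of Lemma A4.2.2 with their `Gal(K/ℚ)`-stability, and the separation of Lemma A4.2.1

Cell pub-hodge-repro2, Tier 6 (README §10), seat t6-p2 (A2 owner). Carrier-free (number-field algebra only;
no interface import). Definition lane: `emb`, `cc`, `Lam`, `LamW`, `Separates`, `comparisons`.

* `emb K τ₁ g = τ₁ ∘ g` — for `K/ℚ` Galois every complex embedding is of this form (used by the A1 glue);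
  `emb_injective`.
* `cc K` — Mathlib's complex conjugation of the CM field (`NumberField.IsCMField.complexConj`) as a
  `ℚ`-automorphism; `emb_cc_trans` / `conjugate_emb`: `τ₁ ∘ (cc ∘ g) = conj (τ₁ ∘ g)`, so the conjugate pairs
  of embeddings are `{g, cc ∘ g}` (TIER4 A0.1: `σ̄ = σ ∘ c`); `cc_trans_ne`: `cc ∘ g ≠ g`.
* `Lam K x = {g(x) g'(x) : g ≠ g'}`, `LamW K x = {g(x) · (cc∘g)(x)}` — the eigenvalue sets of Lemma A4.2.2
  read in `K` (their images under `τ₁` are the eigenvalues of `[x]^*` on `H²(A_i, ℂ)`); `Lam_stable`,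
  `LamW_stable` — both are `Gal(K/ℚ)`-stable (Lemma A4.2.2 (ii), the rationality input of p6's
  `A2Galois.exists_polynomial_map_eq_lagrangeIndicator`); `LamW_subset_Lam`.
* `Separates K x` — LEMMA A4.2.1 as a property: the pair value `g(x)(cc∘g)(x)` is attained only by the
  ordered pairs `(g, cc∘g)`, `(cc∘g, g)`; `exists_separates` — such an `x` exists (p6's
  `A2Separation.exists_separation_le_card` at a primitive element, `x = t + a`); `mem_LamW_iff`,
  `eq_or_eq_cc_trans_of_pair_eq` — the consequences used by the projector.

Imports p6's ACCEPTED `A2Separation` / `A2Primitive` (glue, nothing restated). No `sorry`; standard axioms.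
-/
namespace Summit.Ventures.HodgeRepro2.T6.A2Conj

open NumberField Polynomial

variable (K : Type*) [Field K] [NumberField K]

/-- The embedding `τ₁ ∘ g : K → ℂ` attached to `g ∈ Gal(K/ℚ)` and a base embedding `τ₁`
(for `K/ℚ` Galois every embedding is of this form). -/
noncomputable def emb (τ₁ : K →+* ℂ) (g : K ≃ₐ[ℚ] K) : K →+* ℂ := τ₁.comp (g : K →ₐ[ℚ] K).toRingHom

/-- `emb τ₁ g x = τ₁ (g x)`. -/
theorem emb_apply (τ₁ : K →+* ℂ) (g : K ≃ₐ[ℚ] K) (x : K) : emb K τ₁ g x = τ₁ (g x) := rfl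

/-- `g ↦ τ₁ ∘ g` is injective. -/
theorem emb_injective (τ₁ : K →+* ℂ) : Function.Injective (emb K τ₁) := by
  intro g g' h
  ext x
  exact τ₁.injective (congrArg (fun φ => φ x) h)

variable [IsCMField K]

/-- Complex conjugation of the CM field `K` as a `ℚ`-automorphism (Mathlib `IsCMField.complexConj`). -/
noncomputable def cc : K ≃ₐ[ℚ] K := (IsCMField.complexConj K).restrictScalars ℚ

/-- `cc K x = complexConj K x`. -/
theorem cc_apply (x : K) : cc K x = IsCMField.complexConj K x := rfl

/-- Complex conjugation is an involution: `cc (cc x) = x`. -/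
theorem cc_cc (x : K) : cc K (cc K x) = x := IsCMField.complexConj_apply_apply K x

/-- `cc ∘ (cc ∘ g) = g`. -/
theorem cc_trans_cc_trans (g : K ≃ₐ[ℚ] K) : (cc K).trans ((cc K).trans g) = g := by
  ext x
  simp [AlgEquiv.trans_apply, cc_cc]

/-- The embedding attached to `cc ∘ g` is the complex conjugate of the one attached to `g`:
`τ₁(g(c̄ x)) = conj (τ₁ (g x))` (Mathlib `complexEmbedding_complexConj`). -/
theorem emb_cc_trans (τ₁ : K →+* ℂ) (g : K ≃ₐ[ℚ] K) (x : K) :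
    emb K τ₁ ((cc K).trans g) x = (starRingEnd ℂ) (emb K τ₁ g x) := by
  rw [emb_apply, AlgEquiv.trans_apply, cc_apply, emb_apply]
  exact IsCMField.complexEmbedding_complexConj K (emb K τ₁ g) x

/-- `conjugate (emb τ₁ g) = emb τ₁ (cc ∘ g)` (the conjugate embedding of p1's `IsCMType`). -/
theorem conjugate_emb (τ₁ : K →+* ℂ) (g : K ≃ₐ[ℚ] K) :
    ComplexEmbedding.conjugate (emb K τ₁ g) = emb K τ₁ ((cc K).trans g) := by
  ext x
  rw [ComplexEmbedding.conjugate_coe_eq, emb_cc_trans]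

/-- `cc ∘ g ≠ g` (complex conjugation is not the identity). -/
theorem cc_trans_ne (g : K ≃ₐ[ℚ] K) : (cc K).trans g ≠ g := by
  intro h
  apply IsCMField.complexConj_ne_one K
  ext x
  have := congrArg (fun e => g.symm (e x)) h
  simpa [AlgEquiv.trans_apply, cc_apply] using this

section sets

variable [DecidableEq K] [DecidableEq (K ≃ₐ[ℚ] K)]

/-- `Λ = {g(x) g'(x) : g ≠ g'} ⊂ K`: the eigenvalues of `[x]^*` on `H²(A_i)` read in `K` via `τ₁`
(TIER4 Lemma A4.2.2: `Λ = {σ(x)σ'(x) : σ ≠ σ'}`). -/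
noncomputable def Lam (x : K) : Finset K :=
  (Finset.univ.filter fun p : (K ≃ₐ[ℚ] K) × (K ≃ₐ[ℚ] K) => p.1 ≠ p.2).image fun p => p.1 x * p.2 x

/-- `Λ_W = {g(x) · (cc ∘ g)(x) : g} ⊂ K`: the conjugate-pair eigenvalues `σ(x)σ̄(x)`. -/
noncomputable def LamW (x : K) : Finset K :=
  Finset.univ.image fun g : K ≃ₐ[ℚ] K => g x * ((cc K).trans g) x

omit [IsCMField K] in
/-- `g(x) g'(x) ∈ Λ` for `g ≠ g'`. -/
theorem mem_Lam_of_ne (x : K) {g g' : K ≃ₐ[ℚ] K} (h : g ≠ g') : g x * g' x ∈ Lam K x :=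
  Finset.mem_image.mpr ⟨(g, g'), Finset.mem_filter.mpr ⟨Finset.mem_univ _, h⟩, rfl⟩

omit [DecidableEq (K ≃ₐ[ℚ] K)] in
/-- `g(x) · (cc∘g)(x) ∈ Λ_W`. -/
theorem pair_mem_LamW (x : K) (g : K ≃ₐ[ℚ] K) : g x * ((cc K).trans g) x ∈ LamW K x :=
  Finset.mem_image.mpr ⟨g, Finset.mem_univ _, rfl⟩

/-- `Λ_W ⊆ Λ` (a conjugate pair consists of two distinct embeddings). -/
theorem LamW_subset_Lam (x : K) : LamW K x ⊆ Lam K x := by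
  intro y hy
  obtain ⟨g, -, rfl⟩ := Finset.mem_image.mp hy
  exact mem_Lam_of_ne K x (cc_trans_ne K g).symm

omit [IsCMField K] in
/-- `Λ` is `Gal(K/ℚ)`-stable: `h(g(x)g'(x)) = (h∘g)(x)(h∘g')(x)`. -/
theorem Lam_stable (x : K) (h : K ≃ₐ[ℚ] K) : ∀ y ∈ Lam K x, h y ∈ Lam K x := by
  intro y hy
  obtain ⟨p, hp, rfl⟩ := Finset.mem_image.mp hy
  have hne : p.1 ≠ p.2 := (Finset.mem_filter.mp hp).2
  rw [map_mul]
  refine mem_Lam_of_ne K x (g := p.1.trans h) (g' := p.2.trans h) ?_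
  intro heq
  apply hne
  ext z
  have := congrArg (fun e => h.symm (e z)) heq
  simpa [AlgEquiv.trans_apply] using this

omit [DecidableEq (K ≃ₐ[ℚ] K)] in
/-- `Λ_W` is `Gal(K/ℚ)`-stable (complex conjugation commutes with every automorphism of a CM field). -/
theorem LamW_stable (x : K) (h : K ≃ₐ[ℚ] K) : ∀ y ∈ LamW K x, h y ∈ LamW K x := by
  intro y hy
  obtain ⟨g, -, rfl⟩ := Finset.mem_image.mp hy
  rw [map_mul]
  have : h (((cc K).trans g) x) = ((cc K).trans (g.trans h)) x := by
    simp [AlgEquiv.trans_apply]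
  rw [this]
  exact pair_mem_LamW K x (g.trans h)

end sets


section separation

variable [DecidableEq (K ≃ₐ[ℚ] K)]

/-- LEMMA A4.2.1 (separation of the three conjugate pairs), as a property of `x ∈ K`: the conjugate-pair
eigenvalue `g(x)·(cc∘g)(x)` is attained only by the ordered pairs `(g, cc∘g)` and `(cc∘g, g)`. -/
def Separates (x : K) : Prop :=
  ∀ g : K ≃ₐ[ℚ] K, ∀ p : (K ≃ₐ[ℚ] K) × (K ≃ₐ[ℚ] K), p.1 ≠ p.2 →
    g x * ((cc K).trans g) x = p.1 x * p.2 x → p = (g, (cc K).trans g) ∨ p = ((cc K).trans g, g)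

/-- The comparison set of Lemma A4.2.1: `((g, cc∘g), (g', g''))` with `g' ≠ g''` and `{g', g''} ≠ {g, cc∘g}`. -/
noncomputable def comparisons : Finset (((K ≃ₐ[ℚ] K) × (K ≃ₐ[ℚ] K)) × (K ≃ₐ[ℚ] K) × (K ≃ₐ[ℚ] K)) :=
  Finset.univ.filter fun q => q.1.2 = (cc K).trans q.1.1 ∧ q.2.1 ≠ q.2.2 ∧
    q.2 ≠ (q.1.1, (cc K).trans q.1.1) ∧ q.2 ≠ ((cc K).trans q.1.1, q.1.1)

/-- LEMMA A4.2.1: a separating element exists (p6's `A2Separation.exists_separation_le_card` on the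
evaluation `g ↦ g(a)` at a primitive element `a`, with `x = t + a`). -/
theorem exists_separates : ∃ x : K, Separates K x := by
  obtain ⟨a, ha⟩ := Summit.Ventures.HodgeRepro2.A2Primitive.exists_generator K
  have hinj : Function.Injective fun g : K ≃ₐ[ℚ] K => g a := by
    have h1 := Summit.Ventures.HodgeRepro2.A2Primitive.embedding_eval_injective (L := K) ha
    intro g g' h
    exact AlgEquiv.coe_toAlgHom_injective (h1 (by simpa using h))
  obtain ⟨t, -, ht⟩ := Summit.Ventures.HodgeRepro2.A2Separation.exists_separation_le_card
    (fun g : K ≃ₐ[ℚ] K => g a) hinj (comparisons K) (by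
      intro q hq
      simp only [comparisons, Finset.mem_filter, Finset.mem_univ, true_and] at hq
      obtain ⟨h1, -, h3, h4⟩ := hq
      refine ⟨fun h => h3 ?_, fun h => h4 ?_⟩
      · exact Prod.ext h.1.symm (by rw [← h.2, h1])
      · exact Prod.ext (by rw [← h.2, h1]) h.1.symm)
  refine ⟨(t : K) + a, ?_⟩
  intro g p hp heq
  by_contra hcon
  have hcon' : p ≠ (g, (cc K).trans g) ∧ p ≠ ((cc K).trans g, g) := by
    constructor
    · intro h; exact hcon (Or.inl h)
    · intro h; exact hcon (Or.inr h)
  have hq : ((g, (cc K).trans g), p) ∈ comparisons K := by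
    simp only [comparisons, Finset.mem_filter, Finset.mem_univ, true_and]
    exact ⟨hp, hcon'.1, hcon'.2⟩
  have := ht _ hq
  apply this
  simpa [map_add, map_natCast] using heq

variable [DecidableEq K]

omit [DecidableEq (K ≃ₐ[ℚ] K)] in
/-- For a separating `x` and `g' ≠ g''`: `g'(x)g''(x) ∈ Λ_W` iff `(g', g'') = (g, cc∘g)` for some `g`. -/
theorem mem_LamW_iff {x : K} (hx : Separates K x) (p : (K ≃ₐ[ℚ] K) × (K ≃ₐ[ℚ] K)) (hp : p.1 ≠ p.2) :
    p.1 x * p.2 x ∈ LamW K x ↔ ∃ g : K ≃ₐ[ℚ] K, p = (g, (cc K).trans g) := by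
  constructor
  · intro h
    obtain ⟨g, -, hg⟩ := Finset.mem_image.mp h
    rcases hx g p hp hg with h1 | h1
    · exact ⟨g, h1⟩
    · refine ⟨(cc K).trans g, ?_⟩
      rw [h1, cc_trans_cc_trans]
  · rintro ⟨g, rfl⟩
    exact pair_mem_LamW K x g

omit [DecidableEq (K ≃ₐ[ℚ] K)] [DecidableEq K] in
/-- For a separating `x`: equal conjugate-pair eigenvalues come from the same pair. -/
theorem eq_or_eq_cc_trans_of_pair_eq {x : K} (hx : Separates K x) {g g' : K ≃ₐ[ℚ] K}
    (h : g x * ((cc K).trans g) x = g' x * ((cc K).trans g') x) :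
    g' = g ∨ g' = (cc K).trans g := by
  rcases hx g (g', (cc K).trans g') (cc_trans_ne K g').symm h with h1 | h1
  · exact Or.inl (congrArg Prod.fst h1)
  · exact Or.inr (congrArg Prod.fst h1)

end separation

end Summit.Ventures.HodgeRepro2.T6.A2Conj
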